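import Literature.MathematicalPhysics.QuantumFieldTheory.Balaban1983to89.B5G183RateWThetaHolds

/-!
# Bałaban [CMP 95 (1984)] Prop. 1.1 (1.89) at `U = 1`, order two, weights `W^θ∂_ν ⊗ W^θ∂_{ν′}` in MIXED
directions `ν ≠ ν′`: the eta-rate holds with exponent `min(4θ, 1)`

HONEST FRAMING (cell `pub-balaban`, T⁴ programme, estimate NE2 = U1a «η-rate, linear theory»).  Finite
torus, `η = 1/n`, trivial background `U = 1`, one nonzero reduced momentum `p′` at a time, `ℓ²`-operator
norm on the alias classes `× Fin d`.  Nothing here is about infinite volume, `U ≠ 1`, a mass gap, or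
any summit statement.  Bałaban prints NO rate; the currencies (`B5G183RateWTheta.OrderTwoOpRateResidualWθ`,
and `OrderTwoOpRateResidualWθoff` below), King's pairing, the weights and every constant are OURS ([folklore]).

WHAT IS PRINTED.  [Balaban1984PropagatorsI] p. 33: «Proposition 1.1. The operator G is a symmetric
operator on L²(T_η) and ‖GJ‖, ‖∇GJ‖, ‖G∇*J‖, ‖∇G∇*J‖, ‖∇∇GJ‖, ‖G∇*∇*J‖ ≤ γ₀⁻¹‖J‖, (1.89) with a
positive constant γ₀ independent of k, T_η, and depending on d only (if we put a = 1).»  [King1986]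
p. 672 (4.20) `|u(p′+l)| ≤ Π_μ |p′_μ||p′_μ + l_μ|⁻¹` — a PRODUCT over the coordinates `μ`, one factor
`≤ 1` per coordinate —, (4.22) «≤ C for α < 1.», (4.23) «≤ CL^{−γk} for α + γ < 1»; p. 673 «So keeping
γ + α < 1, the error produced by the above replacement is bounded by CL^{−γk}.»  (renders ref1 p017,
king p024/p025, read as images by this lineage.)

WHAT THIS MODULE PROVES (kernel, [folklore]).  `B5G183RateWThetaHolds` decided the exponent of the
`W^θ∂_ν ⊗ W^θ∂_{ν′}` order-two eta-rate uniformly in the directions: `min(2θ,1)`, and `2θ` is sharp — the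
witness of `B5G183RateWThetaSharp` has `ν = ν′`.  Here the directions are DISTINCT.  King's weight of a
class is a product `W = Π_μ f_μ`, `f_μ ∈ [0,1]`, `f_μ·|q̃_μ| ≤ π` (§2: `wfac`, `Wc_le_wfac_mul`,
`wfac_mul_abs_le`), and the two derivative symbols are controlled coordinatewise, `|∂_ν(q̃)| ≤ |q̃_ν|`,
`|∂^{(RN)}_ν(ιk) − ∂^{(N)}_ν(k)| ≤ 6 q̃_ν²/N` (§2: `norm_dSym_le_abs`, `dSym_rate_le_sq`), so for `ν ≠ ν′`
the two factors `f_ν^{2θ}`, `f_{ν′}^{2θ}` of `W^{2θ}` pay SEPARATELY for the momentum powers of `∂_ν` and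
of `∂_{ν′}` (§1: `rpow_fac_le`, `rpow_fac2_le` and the three cores).  Result:
  **`orderTwoOpRateResidualWθoff_holds d a hθ0 hθ1 :
      OrderTwoOpRateResidualWθoff d a (CXop d a) θ (min (4 * θ) 1)`**, `0 ≤ θ ≤ 1`,
where `OrderTwoOpRateResidualWθoff` is `OrderTwoOpRateResidualWθ` restricted to `ν ≠ ν′` (so the uniform
exponent `min(2θ,1)` is inherited, `orderTwoOpRateResidualWθoff_of_Wθ`), through the entrywise diagonal
bound `dg_entry_mixed_diff_le` (`CdgX1/N^{min(4θ,1)}` for `θ ≤ 1/2`: paired classes off the centre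
`diag_wθ_mixed_rate_le`, unpaired classes `diag_wθ_mixed_unpaired_le`, centre
`B5G183RateW1Diag.centre_diff_le`), the four finite-rank pieces at `CfrW/N`
(`B5G183RateWgtPieces.residualWθ_le_diag_add`), and, for `θ ≥ 1/2`, the landed exponent `1`
(`B5G183RateWThetaHolds.orderTwoOpRateResidualWθ_one_of_half_le`).  In King's language: for `ν ≠ ν′`
the weights of total momentum power `α = 2θ` PER DERIVATIVE buy the rate `γ = min(2α, 1)`.

NOT CLAIMED: sharpness of `4θ` (a separate negative leaf is needed: a doubly off-axis unpaired witness),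
the gap `(1, 4θ]` for `θ > 1/4`, anything for `ν = ν′` beyond `B5G183RateWThetaHolds`, `p′`-derivatives,
`∫dp′`, Prop. 1.2 decay with a rate, `U ≠ 1`, constants.
-/

noncomputable section

namespace Literature.MathematicalPhysics.QuantumFieldTheory.Balaban1983to89.B5G183RateWThetaMixed

open scoped BigOperators ComplexConjugate Matrix.Norms.L2Operator
open Finset Complex
open Literature.MathematicalPhysics.QuantumFieldTheory.Balaban1983to89.B4Strip
open Literature.MathematicalPhysics.QuantumFieldTheory.Balaban1983to89.B5Prop11Fiber
open Literature.MathematicalPhysics.QuantumFieldTheory.Balaban1983to89.B5Prop11Bound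
open Literature.MathematicalPhysics.QuantumFieldTheory.Balaban1983to89.B5Hk163Rate
open Literature.MathematicalPhysics.QuantumFieldTheory.Balaban1983to89.B5Hk163RateSum
open Literature.MathematicalPhysics.QuantumFieldTheory.Balaban1983to89.B5G183Rate
open Literature.MathematicalPhysics.QuantumFieldTheory.Balaban1983to89.B5G183RateSum
open Literature.MathematicalPhysics.QuantumFieldTheory.Balaban1983to89.B5G183RateL2
open Literature.MathematicalPhysics.QuantumFieldTheory.Balaban1983to89.B5G183RateL2Op
open Literature.MathematicalPhysics.QuantumFieldTheory.Balaban1983to89.B5G183RateOp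
open Literature.MathematicalPhysics.QuantumFieldTheory.Balaban1983to89.B5G183RateO2Diag
open Literature.MathematicalPhysics.QuantumFieldTheory.Balaban1983to89.B5G183RateO2Op
open Literature.MathematicalPhysics.QuantumFieldTheory.Balaban1983to89.B5G183RatePieces
open Literature.MathematicalPhysics.QuantumFieldTheory.Balaban1983to89.B5G183RateW1Diag
open Literature.MathematicalPhysics.QuantumFieldTheory.Balaban1983to89.B5G183RateW1RankOne
open Literature.MathematicalPhysics.QuantumFieldTheory.Balaban1983to89.B5G183RateWTheta
open Literature.MathematicalPhysics.QuantumFieldTheory.Balaban1983to89.B5G183RateWgtPieces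
open Literature.MathematicalPhysics.QuantumFieldTheory.Balaban1983to89.B5G183RateWThetaDiag
open Literature.MathematicalPhysics.QuantumFieldTheory.Balaban1983to89.B5G183RateWThetaHolds
open Literature.MathematicalPhysics.QuantumFieldTheory.King1986

variable {d : ℕ}

/-! ## §0 The currency restricted to mixed directions [folklore] -/

section Currency

/-- **the order-two `W^θ∂_ν ⊗ W^θ∂_{ν′}` eta-rate currency in MIXED directions:** the body of
`B5G183RateWTheta.OrderTwoOpRateResidualWθ d a C θ γ` under the extra hypothesis `ν ≠ ν′`. [cite:
Balaban1984PropagatorsI, (1.83) p.31, Prop. 1.1 (1.89) p.33; King1986, (4.20), (4.23) p.672] [folklore] -/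
def OrderTwoOpRateResidualWθoff (d : ℕ) (a C θ γ : ℝ) : Prop :=
  ∀ (N R : ℕ) [NeZero N] [NeZero R] (hN : 1 ≤ N) (hRN : 1 ≤ R * N) (ha : 0 < a) (s : Fin d → ℝ)
    (hs : ∀ ν, |s ν| ≤ Real.pi) (hs0 : s ≠ 0) (ν ν' : Fin d), ν ≠ ν' → 1 ≤ R →
    ‖sandwich (fun K => wθdSym (R * N) θ K s ν) (fun K => wθdSym (R * N) θ K s ν')
          (balabanFiber (R * N) hRN a ha s hs hs0).G
        - plant R s (sandwich (fun k => wθdSym N θ k s ν) (fun k => wθdSym N θ k s ν')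
          (balabanFiber N hN a ha s hs hs0).G)‖
      ≤ C / (N : ℝ) ^ γ

/-- the all-directions currency implies the mixed one (same constant, same exponent). [folklore] -/
theorem orderTwoOpRateResidualWθoff_of_Wθ {d : ℕ} {a C θ γ : ℝ} (h : OrderTwoOpRateResidualWθ d a C θ γ) :
    OrderTwoOpRateResidualWθoff d a C θ γ := by
  intro N R _ _ hN hRN ha s hs hs0 ν ν' _ hR
  exact h N R hN hRN ha s hs hs0 ν ν' hR

/-- monotonicity in the exponent (`C ≥ 0`, `N ≥ 1`). [folklore] -/
theorem orderTwoOpRateResidualWθoff_mono {d : ℕ} {a C θ γ γ' : ℝ} (hC : 0 ≤ C) (hγ : γ' ≤ γ)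
    (h : OrderTwoOpRateResidualWθoff d a C θ γ) : OrderTwoOpRateResidualWθoff d a C θ γ' := by
  intro N R _ _ hN hRN ha s hs hs0 ν ν' hne hR
  have hN1 : (1 : ℝ) ≤ N := by exact_mod_cast hN
  have hN0 : (0 : ℝ) < N := by linarith
  refine (h N R hN hRN ha s hs hs0 ν ν' hne hR).trans ?_
  exact div_le_div_of_nonneg_left hC (Real.rpow_pos_of_pos hN0 _)
    (Real.rpow_le_rpow_of_exponent_le hN1 hγ)

/-- monotonicity in the constant. [folklore] -/
theorem orderTwoOpRateResidualWθoff_of_le_const {d : ℕ} {a C C' θ γ : ℝ} (hC : C ≤ C')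
    (h : OrderTwoOpRateResidualWθoff d a C θ γ) : OrderTwoOpRateResidualWθoff d a C' θ γ := by
  intro N R _ _ hN hRN ha s hs hs0 ν ν' hne hR
  have hN0 : (0 : ℝ) < N := by exact_mod_cast hN
  exact (h N R hN hRN ha s hs hs0 ν ν' hne hR).trans
    (div_le_div_of_nonneg_right hC (Real.rpow_nonneg hN0.le _))

end Currency

/-! ## §1 Real-power bookkeeping: one weight factor per derivative [folklore] -/

section Rpow

/-- **one factor pays for one coordinate:** `0 ≤ f`, `0 ≤ x ≤ M`, `f·x ≤ π`, `0 ≤ 2θ ≤ β` give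
`f^{2θ}·x^β = (fx)^{2θ}·x^{β−2θ} ≤ π^{2θ}·M^{β−2θ}`. [cite: King1986, (4.20), (4.22)–(4.23) p.672]
[folklore] -/
theorem rpow_fac_le {f x M θ β : ℝ} (hf : 0 ≤ f) (hx : 0 ≤ x) (hxM : x ≤ M) (hfx : f * x ≤ Real.pi)
    (hθ : 0 ≤ θ) (hβ : 2 * θ ≤ β) : f ^ (2 * θ) * x ^ β ≤ Real.pi ^ (2 * θ) * M ^ (β - 2 * θ) := by
  have hπ := Real.pi_pos
  have hM : 0 ≤ M := hx.trans hxM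
  have h1 : (f * x) ^ (2 * θ) ≤ Real.pi ^ (2 * θ) :=
    Real.rpow_le_rpow (mul_nonneg hf hx) hfx (by linarith)
  have h2 : x ^ (β - 2 * θ) ≤ M ^ (β - 2 * θ) := Real.rpow_le_rpow hx hxM (by linarith)
  rcases hx.eq_or_lt with h0 | hxpos
  · -- x = 0
    rw [← h0]
    rcases eq_or_ne β 0 with hb | hb
    · have hθ0 : θ = 0 := by linarith
      rw [hb, hθ0, mul_zero, Real.rpow_zero, Real.rpow_zero, Real.rpow_zero, zero_sub, neg_zero,
        Real.rpow_zero]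
    · rw [Real.zero_rpow hb, mul_zero]
      exact mul_nonneg (Real.rpow_nonneg hπ.le _) (Real.rpow_nonneg hM _)
  · have e : x ^ β = x ^ (2 * θ) * x ^ (β - 2 * θ) := by
      rw [← Real.rpow_add hxpos]; congr 1; ring
    calc f ^ (2 * θ) * x ^ β = (f * x) ^ (2 * θ) * x ^ (β - 2 * θ) := by
          rw [e, Real.mul_rpow hf hx]; ring
      _ ≤ Real.pi ^ (2 * θ) * M ^ (β - 2 * θ) :=
          mul_le_mul h1 h2 (Real.rpow_nonneg hx _) (Real.rpow_nonneg hπ.le _)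

/-- the case `β = 1` (`2θ ≤ 1`): `f^{2θ}·x ≤ π^{2θ}·M^{1−2θ}`. [folklore] -/
theorem rpow_fac_one_le {f x M θ : ℝ} (hf : 0 ≤ f) (hx : 0 ≤ x) (hxM : x ≤ M) (hfx : f * x ≤ Real.pi)
    (hθ : 0 ≤ θ) (hθ2 : 2 * θ ≤ 1) : f ^ (2 * θ) * x ≤ Real.pi ^ (2 * θ) * M ^ (1 - 2 * θ) := by
  have h := rpow_fac_le hf hx hxM hfx hθ hθ2
  rwa [Real.rpow_one] at h

/-- **two factors, two coordinates:** `(f g)^{2θ}·x^β·y ≤ π^{4θ}·M^{β+1−4θ}` for `f, g ≥ 0`, `0 ≤ x, y ≤ M`,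
`M > 0`, `fx, gy ≤ π`, `0 ≤ 2θ ≤ min(β, 1)`. [cite: King1986, (4.20), (4.23) p.672] [folklore] -/
theorem rpow_fac2_le {f g x y M θ β : ℝ} (hf : 0 ≤ f) (hg : 0 ≤ g) (hx : 0 ≤ x) (hy : 0 ≤ y)
    (hxM : x ≤ M) (hyM : y ≤ M) (hM : 0 < M) (hfx : f * x ≤ Real.pi) (hgy : g * y ≤ Real.pi)
    (hθ : 0 ≤ θ) (hβ : 2 * θ ≤ β) (hθ2 : 2 * θ ≤ 1) :
    (f * g) ^ (2 * θ) * x ^ β * y ≤ Real.pi ^ (4 * θ) * M ^ (β + 1 - 4 * θ) := by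
  have hπ := Real.pi_pos
  have h1 := rpow_fac_le hf hx hxM hfx hθ hβ
  have h2 := rpow_fac_one_le hg hy hyM hgy hθ hθ2
  have e : Real.pi ^ (2 * θ) * M ^ (β - 2 * θ) * (Real.pi ^ (2 * θ) * M ^ (1 - 2 * θ))
      = Real.pi ^ (4 * θ) * M ^ (β + 1 - 4 * θ) := by
    rw [show 4 * θ = 2 * θ + 2 * θ by ring, Real.rpow_add hπ,
      show β + 1 - (2 * θ + 2 * θ) = (β - 2 * θ) + (1 - 2 * θ) by ring, Real.rpow_add hM]
    ring
  calc (f * g) ^ (2 * θ) * x ^ β * y = f ^ (2 * θ) * x ^ β * (g ^ (2 * θ) * y) := by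
        rw [Real.mul_rpow hf hg]; ring
    _ ≤ Real.pi ^ (2 * θ) * M ^ (β - 2 * θ) * (Real.pi ^ (2 * θ) * M ^ (1 - 2 * θ)) :=
        mul_le_mul h1 h2 (mul_nonneg (Real.rpow_nonneg hg _) hy)
          (mul_nonneg (Real.rpow_nonneg hπ.le _) (Real.rpow_nonneg hM.le _))
    _ = Real.pi ^ (4 * θ) * M ^ (β + 1 - 4 * θ) := e

/-- `π^{4θ} ≤ π²` for `0 ≤ 2θ ≤ 1`. [folklore] -/
theorem pi_rpow_four_mul_le {θ : ℝ} (hθ2 : 2 * θ ≤ 1) : Real.pi ^ (4 * θ) ≤ Real.pi ^ 2 := by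
  have h1 : (1 : ℝ) ≤ Real.pi := by linarith [Real.pi_gt_three]
  calc Real.pi ^ (4 * θ) ≤ Real.pi ^ (2 : ℝ) := Real.rpow_le_rpow_of_exponent_le h1 (by linarith)
    _ = Real.pi ^ 2 := Real.rpow_two _

/-- **the replacement core (terms 1, 2 of the three-term split):** with `t ≤ 4θ`, `1 ≤ M`, `M²·D ≤ π²/4`
(`D = Δ⁻¹`): `(fg)^{2θ}·x^{1+t}·y·D ≤ π²·(π²/4)` — `π^{4θ}M^{2+t−4θ}D = π^{4θ}·M^{t−4θ}·(M²D)`.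
[cite: King1986, (4.20), (4.23) p.672, (4.29)–(4.31) p.673] [folklore] -/
theorem T_core_le {f g x y M D θ t : ℝ} (hf : 0 ≤ f) (hg : 0 ≤ g) (hx : 0 ≤ x) (hy : 0 ≤ y)
    (hxM : x ≤ M) (hyM : y ≤ M) (hM1 : 1 ≤ M) (hfx : f * x ≤ Real.pi) (hgy : g * y ≤ Real.pi)
    (hθ : 0 ≤ θ) (hθ2 : 2 * θ ≤ 1) (ht0 : 0 ≤ t) (ht : t ≤ 4 * θ) (hD : 0 ≤ D)
    (hMD : M ^ 2 * D ≤ Real.pi ^ 2 / 4) :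
    (f * g) ^ (2 * θ) * x ^ (1 + t) * y * D ≤ Real.pi ^ 2 * (Real.pi ^ 2 / 4) := by
  have hπ := Real.pi_pos
  have hM : 0 < M := by linarith
  have h1 := rpow_fac2_le hf hg hx hy hxM hyM hM hfx hgy hθ (by linarith) hθ2 (β := 1 + t)
  have e : M ^ (1 + t + 1 - 4 * θ) = M ^ (t - 4 * θ) * M ^ 2 := by
    rw [show 1 + t + 1 - 4 * θ = (t - 4 * θ) + 2 by ring, Real.rpow_add hM, Real.rpow_two]
  have h2 : M ^ (t - 4 * θ) ≤ 1 := Real.rpow_le_one_of_one_le_of_nonpos hM1 (by linarith)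
  have h3 := pi_rpow_four_mul_le hθ2
  calc (f * g) ^ (2 * θ) * x ^ (1 + t) * y * D
      ≤ Real.pi ^ (4 * θ) * M ^ (1 + t + 1 - 4 * θ) * D := mul_le_mul_of_nonneg_right h1 hD
    _ = Real.pi ^ (4 * θ) * M ^ (t - 4 * θ) * (M ^ 2 * D) := by rw [e]; ring
    _ ≤ Real.pi ^ 2 * 1 * (Real.pi ^ 2 / 4) :=
        mul_le_mul (mul_le_mul h3 h2 (Real.rpow_nonneg hM.le _) (by positivity)) hMD
          (by positivity) (by positivity)
    _ = Real.pi ^ 2 * (Real.pi ^ 2 / 4) := by ring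

/-- **the `Δ⁻¹`-difference core (term 3):** `x, y ≤ M ≤ πN` give `(fg)^{2θ}·x·y ≤ π²·N^{2−4θ}`.
[cite: King1986, (4.20), (4.23) p.672] [folklore] -/
theorem S_core_le {f g x y M θ N : ℝ} (hf : 0 ≤ f) (hg : 0 ≤ g) (hx : 0 ≤ x) (hy : 0 ≤ y)
    (hxM : x ≤ M) (hyM : y ≤ M) (hM : 0 < M) (hMN : M ≤ Real.pi * N) (hN : 0 < N)
    (hfx : f * x ≤ Real.pi) (hgy : g * y ≤ Real.pi) (hθ : 0 ≤ θ) (hθ2 : 2 * θ ≤ 1) :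
    (f * g) ^ (2 * θ) * x * y ≤ Real.pi ^ 2 * N ^ (2 - 4 * θ) := by
  have hπ := Real.pi_pos
  have h1 := rpow_fac2_le hf hg hx hy hxM hyM hM hfx hgy hθ hθ2 hθ2 (β := 1)
  rw [Real.rpow_one] at h1
  have h2 : M ^ (1 + 1 - 4 * θ) ≤ (Real.pi * N) ^ (2 - 4 * θ) := by
    rw [show (1 : ℝ) + 1 - 4 * θ = 2 - 4 * θ by ring]
    exact Real.rpow_le_rpow hM.le hMN (by linarith)
  calc (f * g) ^ (2 * θ) * x * y ≤ Real.pi ^ (4 * θ) * M ^ (1 + 1 - 4 * θ) := h1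
    _ ≤ Real.pi ^ (4 * θ) * (Real.pi * N) ^ (2 - 4 * θ) :=
        mul_le_mul_of_nonneg_left h2 (Real.rpow_nonneg hπ.le _)
    _ = Real.pi ^ 2 * N ^ (2 - 4 * θ) := by
        rw [Real.mul_rpow hπ.le hN.le, ← mul_assoc, ← Real.rpow_add hπ,
          show 4 * θ + (2 - 4 * θ) = (2 : ℝ) by ring, Real.rpow_two]

/-- **the unpaired core:** `x, y ≤ M`, `N ≤ M`, `M²·D ≤ π²/4` give `(fg)^{2θ}·x·y·D ≤ π²(π²/4)·N^{−4θ}`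
(`π^{4θ}M^{2−4θ}D = π^{4θ}·M^{−4θ}·(M²D)`, `M^{−4θ} ≤ N^{−4θ}`). [cite: King1986, (4.19)–(4.20) p.672]
[folklore] -/
theorem U_core_le {f g x y M D θ N : ℝ} (hf : 0 ≤ f) (hg : 0 ≤ g) (hx : 0 ≤ x) (hy : 0 ≤ y)
    (hxM : x ≤ M) (hyM : y ≤ M) (hN : 0 < N) (hNM : N ≤ M) (hfx : f * x ≤ Real.pi)
    (hgy : g * y ≤ Real.pi) (hθ : 0 ≤ θ) (hθ2 : 2 * θ ≤ 1) (hD : 0 ≤ D)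
    (hMD : M ^ 2 * D ≤ Real.pi ^ 2 / 4) :
    (f * g) ^ (2 * θ) * x * y * D ≤ Real.pi ^ 2 * (Real.pi ^ 2 / 4) * N ^ (-(4 * θ)) := by
  have hπ := Real.pi_pos
  have hM : 0 < M := lt_of_lt_of_le hN hNM
  have h1 := rpow_fac2_le hf hg hx hy hxM hyM hM hfx hgy hθ hθ2 hθ2 (β := 1)
  rw [Real.rpow_one] at h1
  have e : M ^ (1 + 1 - 4 * θ) = M ^ (-(4 * θ)) * M ^ 2 := by
    rw [show (1 : ℝ) + 1 - 4 * θ = -(4 * θ) + 2 by ring, Real.rpow_add hM, Real.rpow_two]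
  have h2 : M ^ (-(4 * θ)) ≤ N ^ (-(4 * θ)) := Real.rpow_le_rpow_of_nonpos hN hNM (by linarith)
  have h3 := pi_rpow_four_mul_le hθ2
  calc (f * g) ^ (2 * θ) * x * y * D ≤ Real.pi ^ (4 * θ) * M ^ (1 + 1 - 4 * θ) * D :=
        mul_le_mul_of_nonneg_right h1 hD
    _ = Real.pi ^ (4 * θ) * M ^ (-(4 * θ)) * (M ^ 2 * D) := by rw [e]; ring
    _ ≤ Real.pi ^ 2 * N ^ (-(4 * θ)) * (Real.pi ^ 2 / 4) :=
        mul_le_mul (mul_le_mul h3 h2 (Real.rpow_nonneg hM.le _) (by positivity)) hMD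
          (by positivity) (by positivity)
    _ = Real.pi ^ 2 * (Real.pi ^ 2 / 4) * N ^ (-(4 * θ)) := by ring

/-- **interpolation of the two derivative-replacement bounds:** `0 ≤ u ≤ 2x`, `u ≤ 6x²/N`, `0 ≤ t ≤ 1`
give `u ≤ 6·x^{1+t}·N^{−t}` (`u = u^{1−t}u^t ≤ (6x)^{1−t}(6x²/N)^t`). [folklore] -/
theorem interp_le {u x N t : ℝ} (hu : 0 ≤ u) (hx : 0 ≤ x) (hN : 0 < N) (h1 : u ≤ 2 * x)
    (h2 : u ≤ 6 * x ^ 2 / N) (ht0 : 0 ≤ t) (ht1 : t ≤ 1) :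
    u ≤ 6 * x ^ (1 + t) * N ^ (-t) := by
  rcases hu.eq_or_lt with h0 | hupos
  · rw [← h0]; positivity
  · have hxpos : 0 < x := by linarith
    have h1' : u ≤ 6 * x := by linarith
    have e0 : u = u ^ (1 - t) * u ^ t := by
      rw [← Real.rpow_add hupos, show 1 - t + t = (1 : ℝ) by ring, Real.rpow_one]
    have ha : u ^ (1 - t) ≤ (6 * x) ^ (1 - t) := Real.rpow_le_rpow hu h1' (by linarith)
    have hb : u ^ t ≤ (6 * x ^ 2 / N) ^ t := Real.rpow_le_rpow hu h2 ht0
    have e1 : (6 * x) ^ (1 - t) * (6 * x ^ 2 / N) ^ t = 6 * x ^ (1 + t) * N ^ (-t) := by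
      rw [Real.mul_rpow (by norm_num) hx, Real.div_rpow (by positivity) hN.le,
        Real.mul_rpow (by norm_num) (sq_nonneg x), show x ^ 2 = x ^ (2 : ℝ) from (Real.rpow_two x).symm,
        ← Real.rpow_mul hx, Real.rpow_neg hN.le]
      have e6 : (6 : ℝ) ^ (1 - t) * (6 : ℝ) ^ t = 6 := by
        rw [← Real.rpow_add (by norm_num), show 1 - t + t = (1 : ℝ) by ring, Real.rpow_one]
      have ex : x ^ (1 - t) * x ^ (2 * t) = x ^ (1 + t) := by
        rw [← Real.rpow_add hxpos]; congr 1; ring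
      calc (6 : ℝ) ^ (1 - t) * x ^ (1 - t) * ((6 : ℝ) ^ t * x ^ (2 * t) / N ^ t)
          = ((6 : ℝ) ^ (1 - t) * (6 : ℝ) ^ t) * (x ^ (1 - t) * x ^ (2 * t)) / N ^ t := by ring
        _ = 6 * x ^ (1 + t) / N ^ t := by rw [e6, ex]
        _ = 6 * x ^ (1 + t) * (N ^ t)⁻¹ := by rw [div_eq_mul_inv]
    calc u = u ^ (1 - t) * u ^ t := e0
      _ ≤ (6 * x) ^ (1 - t) * (6 * x ^ 2 / N) ^ t :=
          mul_le_mul ha hb (Real.rpow_nonneg hu _) (Real.rpow_nonneg (by positivity) _)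
      _ = 6 * x ^ (1 + t) * N ^ (-t) := e1

end Rpow

/-! ## §2 King's weight is a product: one factor per coordinate; per-coordinate derivative bounds [folklore] -/

section Factors

/-- the `μ`-th factor of King's weight (4.20)/(4.23): `1` on an inactive coordinate (`j_μ = 0`), else
`|p′_μ|/|p′_μ + 2πj_μ|`. [cite: King1986, (4.20), (4.23) p.672] [folklore] -/
def wfac (s : Fin d → ℝ) (j : Fin d → ℤ) (μ : Fin d) : ℝ :=
  if j μ = 0 then (1 : ℝ) else |s μ| / |s μ + 2 * Real.pi * j μ|

/-- `aliasWeight p′ j = Π_μ wfac p′ j μ`. [cite: King1986, (4.20) p.672] [folklore] -/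
theorem aliasWeight_eq_prod_wfac (s : Fin d → ℝ) (j : Fin d → ℤ) :
    aliasWeight s j = ∏ μ, wfac s j μ := rfl

/-- `0 ≤ wfac ≤ 1` (`|p′_μ| ≤ π ≤ |p′_μ + 2πj_μ|` on an active coordinate). [cite: King1986, (4.20) p.672]
[folklore] -/
theorem wfac_nonneg_le_one {s : Fin d → ℝ} (hs : ∀ μ, |s μ| ≤ Real.pi) (j : Fin d → ℤ) (μ : Fin d) :
    0 ≤ wfac s j μ ∧ wfac s j μ ≤ 1 := by
  unfold wfac
  split_ifs with h
  · exact ⟨zero_le_one, le_rfl⟩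
  · have hπ := pi_le_abs_add (hs μ) h
    have hpos : 0 < |s μ + 2 * Real.pi * j μ| := lt_of_lt_of_le Real.pi_pos hπ
    exact ⟨div_nonneg (abs_nonneg _) (abs_nonneg _), (div_le_one hpos).mpr ((hs μ).trans hπ)⟩

/-- **one factor absorbs its own coordinate:** `wfac p′ j μ · |(p′ + 2πj)_μ| ≤ π`. [cite: King1986,
(4.20) p.672] [folklore] -/
theorem wfac_mul_abs_le {s : Fin d → ℝ} (hs : ∀ μ, |s μ| ≤ Real.pi) (j : Fin d → ℤ) (μ : Fin d) :
    wfac s j μ * |aliasPt s j μ| ≤ Real.pi := by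
  unfold wfac aliasPt
  split_ifs with h
  · rw [h]; push_cast; rw [mul_zero, add_zero, one_mul]; exact hs μ
  · have hπ := pi_le_abs_add (hs μ) h
    have hpos : 0 < |s μ + 2 * Real.pi * j μ| := lt_of_lt_of_le Real.pi_pos hπ
    rw [div_mul_cancel₀ _ hpos.ne']
    exact hs μ

/-- **for two DISTINCT coordinates the weight is at most the product of their two factors** (all other
factors lie in `[0,1]`). [cite: King1986, (4.20) p.672] [folklore] -/
theorem aliasWeight_le_wfac_mul {s : Fin d → ℝ} (hs : ∀ μ, |s μ| ≤ Real.pi) (j : Fin d → ℤ)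
    {ν ν' : Fin d} (hne : ν ≠ ν') : aliasWeight s j ≤ wfac s j ν * wfac s j ν' := by
  rw [aliasWeight_eq_prod_wfac, ← Finset.mul_prod_erase Finset.univ _ (Finset.mem_univ ν),
    ← Finset.mul_prod_erase (Finset.univ.erase ν) _ (Finset.mem_erase.mpr ⟨hne.symm, Finset.mem_univ ν'⟩),
    ← mul_assoc]
  have h1 : ∏ μ ∈ (Finset.univ.erase ν).erase ν', wfac s j μ ≤ 1 :=
    Finset.prod_le_one (fun μ _ => (wfac_nonneg_le_one hs j μ).1) (fun μ _ => (wfac_nonneg_le_one hs j μ).2)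
  have h0 : 0 ≤ wfac s j ν * wfac s j ν' :=
    mul_nonneg (wfac_nonneg_le_one hs j ν).1 (wfac_nonneg_le_one hs j ν').1
  calc wfac s j ν * wfac s j ν' * ∏ μ ∈ (Finset.univ.erase ν).erase ν', wfac s j μ
      ≤ wfac s j ν * wfac s j ν' * 1 := mul_le_mul_of_nonneg_left h1 h0
    _ = wfac s j ν * wfac s j ν' := mul_one _

/-- hence for the class weight `Wc n K p′ = aliasWeight p′ (jOf n K p′)` and `ν ≠ ν′`:
`Wc ≤ wfac_ν · wfac_{ν′}`. [cite: King1986, (4.20) p.672] [folklore] -/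
theorem Wc_le_wfac_mul {n : ℕ} (K : Fin d → Fin n) {s : Fin d → ℝ} (hs : ∀ μ, |s μ| ≤ Real.pi)
    {ν ν' : Fin d} (hne : ν ≠ ν') :
    Wc n K s ≤ wfac s (jOf n K s) ν * wfac s (jOf n K s) ν' :=
  aliasWeight_le_wfac_mul hs _ hne

/-- the coordinates of the symmetric representative are those of King's alias point:
`|q̃_μ| = |(p′ + 2πj)_μ|`, `j = jOf`. [folklore] -/
theorem abs_symmAlias_eq (n : ℕ) (K : Fin d → Fin n) (s : Fin d → ℝ) (μ : Fin d) :
    |symmAlias n K s μ| = |aliasPt s (jOf n K s) μ| := by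
  rw [symmAlias_eq_aliasPt]

/-- **per-coordinate:** `|∂^{(n)}_ν(q)| ≤ |q̃_ν|` (`|∂_ν|² = S_ξ(q̃_ν) ≤ q̃_ν²`). [folklore] -/
theorem norm_dSym_le_abs {n : ℕ} (hn : 1 ≤ n) (k : Fin d → Fin n) (s : Fin d → ℝ) (ν : Fin d) :
    ‖dSym n k s ν‖ ≤ |symmAlias n k s ν| := by
  have h1 : ‖dSym n k s ν‖ ^ 2 = Sxir n (symmAlias n k s ν) := by
    rw [dSym_eq_symmAlias hn, norm_mul, mul_pow, Complex.norm_natCast, norm_exp_mul_I_sub_one_sq,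
      Sxir_eq_sq_mul_S1r]
  have h2 : Sxir n (symmAlias n k s ν) ≤ |symmAlias n k s ν| ^ 2 := by
    rw [sq_abs]; exact Sxir_le n _
  rw [← h1] at h2
  exact (pow_le_pow_iff_left₀ (norm_nonneg _) (abs_nonneg _) two_ne_zero).mp h2

/-- **per-coordinate replacement rate between PAIRED classes:** `|∂^{(RN)}_ν(ιk) − ∂^{(N)}_ν(k)| ≤ 6 q̃_ν²/N`
(both are `n(e^{i q̃_ν/n} − 1)` at the SAME `q̃_ν`, each within `3q̃_ν²/n` of `i q̃_ν`). [cite: King1986,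
(4.29)–(4.31) p.673 (rate bookkeeping ours)] [folklore] -/
theorem dSym_rate_le_sq {N R : ℕ} [NeZero R] (hN : 1 ≤ N) (hR : 1 ≤ R) (k : Fin d → Fin N)
    {s : Fin d → ℝ} (hs : ∀ ν, |s ν| ≤ Real.pi) (ν : Fin d) :
    ‖dSym (R * N) (iota R k s) s ν - dSym N k s ν‖ ≤ 6 * (symmAlias N k s ν) ^ 2 / N := by
  have hN0 : (0 : ℝ) < N := by exact_mod_cast hN
  have hRN : 1 ≤ R * N := one_le_RN hN hR
  set y := symmAlias N k s ν with hy
  have e1 : dSym N k s ν = (N : ℂ) * (Complex.exp (((y / N : ℝ) : ℂ) * I) - 1) :=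
    dSym_eq_symmAlias hN k s ν
  have e2 : dSym (R * N) (iota R k s) s ν
      = ((R * N : ℕ) : ℂ) * (Complex.exp (((y / (R * N : ℕ) : ℝ) : ℂ) * I) - 1) := by
    rw [dSym_eq_symmAlias hRN, symmAlias_iota hN k hs]
  have h1 := norm_latDeriv_sub_le hN y
  have h2 := norm_latDeriv_sub_le hRN y
  have h3 : ‖dSym (R * N) (iota R k s) s ν - dSym N k s ν‖ ≤ 3 * y ^ 2 / (R * N : ℕ) + 3 * y ^ 2 / N := by
    rw [e1, e2]
    calc ‖((R * N : ℕ) : ℂ) * (Complex.exp (((y / (R * N : ℕ) : ℝ) : ℂ) * I) - 1)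
            - (N : ℂ) * (Complex.exp (((y / N : ℝ) : ℂ) * I) - 1)‖
        = ‖(((R * N : ℕ) : ℂ) * (Complex.exp (((y / (R * N : ℕ) : ℝ) : ℂ) * I) - 1) - (y : ℂ) * I)
            - ((N : ℂ) * (Complex.exp (((y / N : ℝ) : ℂ) * I) - 1) - (y : ℂ) * I)‖ := by
          congr 1; ring
      _ ≤ 3 * y ^ 2 / (R * N : ℕ) + 3 * y ^ 2 / N := (norm_sub_le _ _).trans (add_le_add h2 h1)
  have h4 : 3 * y ^ 2 / (R * N : ℕ) ≤ 3 * y ^ 2 / N := by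
    apply div_le_div_of_nonneg_left (by positivity) hN0
    exact_mod_cast Nat.le_mul_of_pos_left N (by omega)
  calc ‖dSym (R * N) (iota R k s) s ν - dSym N k s ν‖
      ≤ 3 * y ^ 2 / (R * N : ℕ) + 3 * y ^ 2 / N := h3
    _ ≤ 3 * y ^ 2 / N + 3 * y ^ 2 / N := add_le_add h4 le_rfl
    _ = 6 * y ^ 2 / N := by ring

end Factors

/-! ## §3 Paired classes off the centre, `ν ≠ ν′`, `θ ≤ 1/2`: rate `CdgX/N^{min(4θ,1)}` [folklore] -/

section Paired

/-- the constant of the mixed paired rate: `2·6π²(π²/4) + π²(π²/24)`. [folklore] -/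
def CdgX : ℝ := 12 * Real.pi ^ 2 * (Real.pi ^ 2 / 4) + Real.pi ^ 2 * (Real.pi ^ 2 / 24)

/-- `0 ≤ CdgX`. [folklore] -/
theorem CdgX_nonneg : 0 ≤ CdgX := by unfold CdgX; positivity

variable {N R : ℕ} [NeZero N] [NeZero R]

/-- **PAIRED diagonal off the centre, MIXED directions `ν ≠ ν′`, weights `W^θ ⊗ W^θ` with `θ ≤ 1/2`:**
`(Wc^θ)²·‖w2 (RN) (ιk) ν ν′ − w2 N k ν ν′‖ ≤ CdgX/N^{min(4θ,1)}` for `k ≠ 0`.  Three-term split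
(`B5G183RateO2Diag.norm_three_split_le`); in the two replacement terms the replaced derivative is
interpolated, `|∂^{(RN)}_ν − ∂^{(N)}_ν| ≤ 6|q̃_ν|^{1+t}N^{−t}` (`t = min(4θ,1)`, `interp_le`), and
`W^{2θ} ≤ (f_ν f_{ν′})^{2θ}` pays `f_ν^{2θ}|q̃_ν|^{1+t} ≤ π^{2θ}‖q̃‖^{1+t−2θ}`, `f_{ν′}^{2θ}|q̃_{ν′}| ≤
π^{2θ}‖q̃‖^{1−2θ}`, closed by `‖q̃‖²Δ⁻¹ ≤ π²/4` (`T_core_le`); the `Δ⁻¹`-difference term carries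
`(f_ν f_{ν′})^{2θ}|q̃_ν||q̃_{ν′}| ≤ π²N^{2−4θ}` against `(π²/24)/N²` (`S_core_le`). [cite:
Balaban1984PropagatorsI, Prop. 1.1 (1.89) p.33; King1986, (4.20), (4.23) p.672, (4.24), (4.29)–(4.31)
p.673] [folklore] -/
theorem diag_wθ_mixed_rate_le (hN : 1 ≤ N) (hR : 1 ≤ R) {s : Fin d → ℝ} (hs : ∀ ν, |s ν| ≤ Real.pi)
    (ν₀ : Fin d) (hν₀ : s ν₀ ≠ 0) {k : Fin d → Fin N} (hk : k ≠ 0) {ν ν' : Fin d} (hne : ν ≠ ν')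
    {θ : ℝ} (hθ0 : 0 ≤ θ) (hθ2 : 2 * θ ≤ 1) :
    (Wc N k s ^ θ) ^ 2 * ‖w2 (R * N) (iota R k s) s ν ν' - w2 N k s ν ν'‖
      ≤ CdgX / (N : ℝ) ^ min (4 * θ) 1 := by
  have hπ := Real.pi_pos
  have hN0 : (0 : ℝ) < N := by exact_mod_cast hN
  have hN1 : (1 : ℝ) ≤ N := by exact_mod_cast hN
  have hRN : 1 ≤ R * N := one_le_RN hN hR
  set t : ℝ := min (4 * θ) 1 with ht
  have ht4 : t ≤ 4 * θ := min_le_left _ _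
  have ht1 : t ≤ 1 := min_le_right _ _
  have ht0 : 0 ≤ t := le_min (by linarith) zero_le_one
  have hNt : 0 < (N : ℝ) ^ t := Real.rpow_pos_of_pos hN0 _
  have hN4 : 0 < (N : ℝ) ^ (4 * θ) := Real.rpow_pos_of_pos hN0 _
  have hNt4 : (N : ℝ) ^ t ≤ (N : ℝ) ^ (4 * θ) := Real.rpow_le_rpow_of_exponent_le hN1 ht4
  unfold w2
  rw [symmAlias_iota hN k hs]
  set q := symmAlias N k s with hqdef
  have hr := isRep_symmAlias hN k hs
  have hpos : 0 < momSq q := momSq_pos_of_rep hs ν₀ hν₀ hr.exists_int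
  have hzR : ∀ μ, |q μ| ≤ Real.pi * ((R * N : ℕ) : ℝ) := by
    intro μ
    have h := (isRep_symmAlias hRN (iota R k s) hs).zone μ
    rwa [symmAlias_iota hN k hs] at h
  have hqN : ‖q‖ ≤ Real.pi * N :=
    (pi_norm_le_iff_of_nonneg (by positivity)).mpr fun μ => by
      rw [Real.norm_eq_abs]; exact hr.zone μ
  -- King's label and the two weight factors
  set j := jOf N k s with hjdef
  have hj : j ≠ 0 := fun h => hk ((jOf_eq_zero_iff hN hs k).mp h)
  have hq1 : 1 ≤ ‖q‖ := by
    rw [hqdef, symmAlias_eq_aliasPt]; exact one_le_norm_aliasPt hs hj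
  have hqpos : 0 < ‖q‖ := by linarith
  set f := wfac s j ν with hfdef
  set g := wfac s j ν' with hgdef
  have hf := wfac_nonneg_le_one hs j ν
  have hg := wfac_nonneg_le_one hs j ν'
  set x := |q ν| with hxdef
  set y := |q ν'| with hydef
  have hx0 : 0 ≤ x := abs_nonneg _
  have hy0 : 0 ≤ y := abs_nonneg _
  have hxM : x ≤ ‖q‖ := by rw [hxdef, ← Real.norm_eq_abs]; exact norm_le_pi_norm q ν
  have hyM : y ≤ ‖q‖ := by rw [hydef, ← Real.norm_eq_abs]; exact norm_le_pi_norm q ν'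
  have hfx : f * x ≤ Real.pi := by
    rw [hxdef, hqdef, abs_symmAlias_eq]; exact wfac_mul_abs_le hs j ν
  have hgy : g * y ≤ Real.pi := by
    rw [hydef, hqdef, abs_symmAlias_eq]; exact wfac_mul_abs_le hs j ν'
  have hW := Wc_nonneg_le_one (n := N) k hs
  have hWfg : (Wc N k s ^ θ) ^ 2 ≤ (f * g) ^ (2 * θ) := by
    rw [rpow_sq_eq hW.1]
    exact Real.rpow_le_rpow hW.1 (Wc_le_wfac_mul k hs hne) (by linarith)
  have hW0 : 0 ≤ (Wc N k s ^ θ) ^ 2 := sq_nonneg _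
  have hfg0 : 0 ≤ (f * g) ^ (2 * θ) := Real.rpow_nonneg (mul_nonneg hf.1 hg.1) _
  -- the per-coordinate inputs
  have hAx : ‖dSym (R * N) (iota R k s) s ν - dSym N k s ν‖ ≤ 6 * x ^ (1 + t) * (N : ℝ) ^ (-t) := by
    refine interp_le (norm_nonneg _) hx0 hN0 ?_ ?_ ht0 ht1
    · calc ‖dSym (R * N) (iota R k s) s ν - dSym N k s ν‖
          ≤ ‖dSym (R * N) (iota R k s) s ν‖ + ‖dSym N k s ν‖ := norm_sub_le _ _
        _ ≤ x + x := by
            refine add_le_add ?_ (norm_dSym_le_abs hN k s ν)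
            have h := norm_dSym_le_abs hRN (iota R k s) s ν
            rwa [symmAlias_iota hN k hs] at h
        _ = 2 * x := by ring
    · rw [hxdef, sq_abs]; exact dSym_rate_le_sq hN hR k hs ν
  have hBy : ‖conj (dSym (R * N) (iota R k s) s ν') - conj (dSym N k s ν')‖
      ≤ 6 * y ^ (1 + t) * (N : ℝ) ^ (-t) := by
    rw [← map_sub, Complex.norm_conj]
    refine interp_le (norm_nonneg _) hy0 hN0 ?_ ?_ ht0 ht1
    · calc ‖dSym (R * N) (iota R k s) s ν' - dSym N k s ν'‖
          ≤ ‖dSym (R * N) (iota R k s) s ν'‖ + ‖dSym N k s ν'‖ := norm_sub_le _ _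
        _ ≤ y + y := by
            refine add_le_add ?_ (norm_dSym_le_abs hN k s ν')
            have h := norm_dSym_le_abs hRN (iota R k s) s ν'
            rwa [symmAlias_iota hN k hs] at h
        _ = 2 * y := by ring
    · rw [hydef, sq_abs]; exact dSym_rate_le_sq hN hR k hs ν'
  have hA0 : ‖dSym N k s ν‖ ≤ x := norm_dSym_le_abs hN k s ν
  have hB0 : ‖conj (dSym N k s ν')‖ ≤ y := by
    rw [Complex.norm_conj]; exact norm_dSym_le_abs hN k s ν'
  have hBR : ‖conj (dSym (R * N) (iota R k s) s ν')‖ ≤ y := by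
    rw [Complex.norm_conj]
    have h := norm_dSym_le_abs hRN (iota R k s) s ν'
    rwa [symmAlias_iota hN k hs] at h
  have ha : ‖q‖ ^ 2 * (DeltaXir (R * N) 0 q)⁻¹ ≤ Real.pi ^ 2 / 4 :=
    norm_sq_mul_inv_DeltaXir_le hRN hzR hpos
  have hapos : 0 < (DeltaXir (R * N) 0 q)⁻¹ :=
    inv_pos.mpr (lt_of_lt_of_le (by positivity) (DeltaXir_ge_momSq hRN hzR))
  have hab : |(DeltaXir (R * N) 0 q)⁻¹ - (DeltaXir N 0 q)⁻¹| ≤ Real.pi ^ 2 / 24 * ((N : ℝ) ^ 2)⁻¹ := by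
    rw [abs_sub_comm]; exact diag_paired_rate hN hR hs ν₀ hν₀ k
  -- the cores
  have c1 : (f * g) ^ (2 * θ) * x ^ (1 + t) * y * (DeltaXir (R * N) 0 q)⁻¹
      ≤ Real.pi ^ 2 * (Real.pi ^ 2 / 4) :=
    T_core_le hf.1 hg.1 hx0 hy0 hxM hyM hq1 hfx hgy hθ0 hθ2 ht0 ht4 hapos.le ha
  have c2 : (g * f) ^ (2 * θ) * y ^ (1 + t) * x * (DeltaXir (R * N) 0 q)⁻¹
      ≤ Real.pi ^ 2 * (Real.pi ^ 2 / 4) :=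
    T_core_le hg.1 hf.1 hy0 hx0 hyM hxM hq1 hgy hfx hθ0 hθ2 ht0 ht4 hapos.le ha
  have c3 : (f * g) ^ (2 * θ) * x * y ≤ Real.pi ^ 2 * (N : ℝ) ^ (2 - 4 * θ) :=
    S_core_le hf.1 hg.1 hx0 hy0 hxM hyM hqpos hqN hN0 hfx hgy hθ0 hθ2
  rw [← Complex.ofReal_inv, ← Complex.ofReal_inv]
  refine (mul_le_mul_of_nonneg_left (norm_three_split_le _ _ _ _ _ _) hW0).trans ?_
  rw [abs_of_pos hapos]
  -- term 1
  have t1 : (Wc N k s ^ θ) ^ 2 * (‖dSym (R * N) (iota R k s) s ν - dSym N k s ν‖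
      * ‖conj (dSym (R * N) (iota R k s) s ν')‖ * (DeltaXir (R * N) 0 q)⁻¹)
      ≤ 6 * (N : ℝ) ^ (-t) * (Real.pi ^ 2 * (Real.pi ^ 2 / 4)) := by
    calc (Wc N k s ^ θ) ^ 2 * (‖dSym (R * N) (iota R k s) s ν - dSym N k s ν‖
          * ‖conj (dSym (R * N) (iota R k s) s ν')‖ * (DeltaXir (R * N) 0 q)⁻¹)
        ≤ (f * g) ^ (2 * θ) * (6 * x ^ (1 + t) * (N : ℝ) ^ (-t) * y * (DeltaXir (R * N) 0 q)⁻¹) := by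
          refine mul_le_mul hWfg ?_ (by positivity) hfg0
          exact mul_le_mul_of_nonneg_right
            (mul_le_mul hAx hBR (norm_nonneg _) (by positivity)) hapos.le
      _ = 6 * (N : ℝ) ^ (-t) * ((f * g) ^ (2 * θ) * x ^ (1 + t) * y * (DeltaXir (R * N) 0 q)⁻¹) := by
          ring
      _ ≤ 6 * (N : ℝ) ^ (-t) * (Real.pi ^ 2 * (Real.pi ^ 2 / 4)) :=
          mul_le_mul_of_nonneg_left c1 (by positivity)
  -- term 2
  have t2 : (Wc N k s ^ θ) ^ 2 * (‖dSym N k s ν‖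
      * ‖conj (dSym (R * N) (iota R k s) s ν') - conj (dSym N k s ν')‖ * (DeltaXir (R * N) 0 q)⁻¹)
      ≤ 6 * (N : ℝ) ^ (-t) * (Real.pi ^ 2 * (Real.pi ^ 2 / 4)) := by
    calc (Wc N k s ^ θ) ^ 2 * (‖dSym N k s ν‖
          * ‖conj (dSym (R * N) (iota R k s) s ν') - conj (dSym N k s ν')‖ * (DeltaXir (R * N) 0 q)⁻¹)
        ≤ (f * g) ^ (2 * θ) * (x * (6 * y ^ (1 + t) * (N : ℝ) ^ (-t)) * (DeltaXir (R * N) 0 q)⁻¹) := by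
          refine mul_le_mul hWfg ?_ (by positivity) hfg0
          exact mul_le_mul_of_nonneg_right (mul_le_mul hA0 hBy (norm_nonneg _) hx0) hapos.le
      _ = 6 * (N : ℝ) ^ (-t) * ((g * f) ^ (2 * θ) * y ^ (1 + t) * x * (DeltaXir (R * N) 0 q)⁻¹) := by
          rw [mul_comm g f]; ring
      _ ≤ 6 * (N : ℝ) ^ (-t) * (Real.pi ^ 2 * (Real.pi ^ 2 / 4)) :=
          mul_le_mul_of_nonneg_left c2 (by positivity)
  -- term 3
  have t3 : (Wc N k s ^ θ) ^ 2 * (‖dSym N k s ν‖ * ‖conj (dSym N k s ν')‖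
      * |(DeltaXir (R * N) 0 q)⁻¹ - (DeltaXir N 0 q)⁻¹|)
      ≤ Real.pi ^ 2 * (N : ℝ) ^ (2 - 4 * θ) * (Real.pi ^ 2 / 24 * ((N : ℝ) ^ 2)⁻¹) := by
    calc (Wc N k s ^ θ) ^ 2 * (‖dSym N k s ν‖ * ‖conj (dSym N k s ν')‖
          * |(DeltaXir (R * N) 0 q)⁻¹ - (DeltaXir N 0 q)⁻¹|)
        ≤ (f * g) ^ (2 * θ) * (x * y * (Real.pi ^ 2 / 24 * ((N : ℝ) ^ 2)⁻¹)) := by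
          refine mul_le_mul hWfg ?_ (by positivity) hfg0
          exact mul_le_mul (mul_le_mul hA0 hB0 (norm_nonneg _) hx0) hab (abs_nonneg _)
            (by positivity)
      _ = (f * g) ^ (2 * θ) * x * y * (Real.pi ^ 2 / 24 * ((N : ℝ) ^ 2)⁻¹) := by ring
      _ ≤ Real.pi ^ 2 * (N : ℝ) ^ (2 - 4 * θ) * (Real.pi ^ 2 / 24 * ((N : ℝ) ^ 2)⁻¹) :=
          mul_le_mul_of_nonneg_right c3 (by positivity)
  have hsum := add_le_add (add_le_add t1 t2) t3
  rw [mul_add, mul_add]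
  refine hsum.trans ?_
  -- `N^{−t} = 1/N^t`, `N^{2−4θ}/N² = 1/N^{4θ} ≤ 1/N^t`
  have e1 : 6 * (N : ℝ) ^ (-t) * (Real.pi ^ 2 * (Real.pi ^ 2 / 4))
      = 6 * Real.pi ^ 2 * (Real.pi ^ 2 / 4) / (N : ℝ) ^ t := by
    rw [Real.rpow_neg hN0.le]
    field_simp
  have e3 : Real.pi ^ 2 * (N : ℝ) ^ (2 - 4 * θ) * (Real.pi ^ 2 / 24 * ((N : ℝ) ^ 2)⁻¹)
      = Real.pi ^ 2 * (Real.pi ^ 2 / 24) / (N : ℝ) ^ (4 * θ) := by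
    rw [Real.rpow_sub hN0, Real.rpow_two]
    field_simp
  have h3 : Real.pi ^ 2 * (Real.pi ^ 2 / 24) / (N : ℝ) ^ (4 * θ)
      ≤ Real.pi ^ 2 * (Real.pi ^ 2 / 24) / (N : ℝ) ^ t :=
    div_le_div_of_nonneg_left (by positivity) hNt hNt4
  rw [e1, e3]
  calc 6 * Real.pi ^ 2 * (Real.pi ^ 2 / 4) / (N : ℝ) ^ t + 6 * Real.pi ^ 2 * (Real.pi ^ 2 / 4) / (N : ℝ) ^ t
        + Real.pi ^ 2 * (Real.pi ^ 2 / 24) / (N : ℝ) ^ (4 * θ)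
      ≤ 6 * Real.pi ^ 2 * (Real.pi ^ 2 / 4) / (N : ℝ) ^ t + 6 * Real.pi ^ 2 * (Real.pi ^ 2 / 4) / (N : ℝ) ^ t
        + Real.pi ^ 2 * (Real.pi ^ 2 / 24) / (N : ℝ) ^ t := by linarith
    _ = CdgX / (N : ℝ) ^ t := by unfold CdgX; field_simp; ring

end Paired

/-! ## §4 Unpaired classes, `ν ≠ ν′`, `θ ≤ 1/2`: the two factors give `π²(π²/4)/N^{4θ}` [folklore] -/

section Unpaired

variable {N R : ℕ} [NeZero N] [NeZero R]

omit [NeZero N] in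
/-- **UNPAIRED diagonal, MIXED directions, `W^θ ⊗ W^θ`, `θ ≤ 1/2`:** on King's `|m| ≥ 1` classes
(`‖q̃″‖_∞ ≥ πN`) `(Wc^θ)²·‖w2 (RN) k″ ν ν′‖ ≤ π²(π²/4)/N^{4θ}` — `(f_ν f_{ν′})^{2θ}|q̃_ν||q̃_{ν′}|Δ⁻¹ ≤
π^{4θ}‖q̃″‖^{−4θ}(‖q̃″‖²Δ⁻¹)` (`U_core_le`); twice the exponent of `B5G183RateWThetaDiag.diag_wθ_unpaired_le`.
[cite: King1986, (4.19)–(4.20) p.672; Balaban1984PropagatorsI, Prop. 1.1 (1.89) p.33] [folklore] -/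
theorem diag_wθ_mixed_unpaired_le (hN : 1 ≤ N) (hR : 1 ≤ R) {s : Fin d → ℝ} (hs : ∀ ν, |s ν| ≤ Real.pi)
    {k'' : Fin d → Fin (R * N)} (hu : ∀ k : Fin d → Fin N, iota R k s ≠ k'') {ν ν' : Fin d}
    (hne : ν ≠ ν') {θ : ℝ} (hθ0 : 0 ≤ θ) (hθ2 : 2 * θ ≤ 1) :
    (Wc (R * N) k'' s ^ θ) ^ 2 * ‖w2 (R * N) k'' s ν ν'‖
      ≤ Real.pi ^ 2 * (Real.pi ^ 2 / 4) / (N : ℝ) ^ (4 * θ) := by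
  have hπ := Real.pi_pos
  have hN0 : (0 : ℝ) < N := by exact_mod_cast hN
  have hN1 : (1 : ℝ) ≤ N := by exact_mod_cast hN
  have hRN : 1 ≤ R * N := one_le_RN hN hR
  unfold w2
  set q := symmAlias (R * N) k'' s with hqdef
  have hr := isRep_symmAlias hRN k'' hs
  have hfar : Real.pi * N ≤ ‖q‖ := norm_ge_of_unpaired hN hs hu
  have hNq : (N : ℝ) ≤ ‖q‖ := by nlinarith [Real.pi_gt_three]
  have hqpos : 0 < ‖q‖ := lt_of_lt_of_le (by positivity) hfar
  have hmpos : 0 < momSq q := lt_of_lt_of_le (by positivity) (norm_sq_le_momSq q)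
  have ha : ‖q‖ ^ 2 * (DeltaXir (R * N) 0 q)⁻¹ ≤ Real.pi ^ 2 / 4 :=
    norm_sq_mul_inv_DeltaXir_le hRN hr.zone hmpos
  have hapos : 0 < (DeltaXir (R * N) 0 q)⁻¹ :=
    inv_pos.mpr (lt_of_lt_of_le (by positivity) (DeltaXir_ge_momSq hRN hr.zone))
  -- the two factors
  set j := jOf (R * N) k'' s with hjdef
  set f := wfac s j ν with hfdef
  set g := wfac s j ν' with hgdef
  have hf := wfac_nonneg_le_one hs j ν
  have hg := wfac_nonneg_le_one hs j ν'
  set x := |q ν| with hxdef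
  set y := |q ν'| with hydef
  have hx0 : 0 ≤ x := abs_nonneg _
  have hy0 : 0 ≤ y := abs_nonneg _
  have hxM : x ≤ ‖q‖ := by rw [hxdef, ← Real.norm_eq_abs]; exact norm_le_pi_norm q ν
  have hyM : y ≤ ‖q‖ := by rw [hydef, ← Real.norm_eq_abs]; exact norm_le_pi_norm q ν'
  have hfx : f * x ≤ Real.pi := by
    rw [hxdef, hqdef, abs_symmAlias_eq]; exact wfac_mul_abs_le hs j ν
  have hgy : g * y ≤ Real.pi := by
    rw [hydef, hqdef, abs_symmAlias_eq]; exact wfac_mul_abs_le hs j ν'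
  have hW := Wc_nonneg_le_one (n := R * N) k'' hs
  have hWfg : (Wc (R * N) k'' s ^ θ) ^ 2 ≤ (f * g) ^ (2 * θ) := by
    rw [rpow_sq_eq hW.1]
    exact Real.rpow_le_rpow hW.1 (Wc_le_wfac_mul k'' hs hne) (by linarith)
  have hfg0 : 0 ≤ (f * g) ^ (2 * θ) := Real.rpow_nonneg (mul_nonneg hf.1 hg.1) _
  have hA : ‖dSym (R * N) k'' s ν‖ ≤ x := norm_dSym_le_abs hRN k'' s ν
  have hB : ‖conj (dSym (R * N) k'' s ν')‖ ≤ y := by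
    rw [Complex.norm_conj]; exact norm_dSym_le_abs hRN k'' s ν'
  have hw : ‖dSym (R * N) k'' s ν * conj (dSym (R * N) k'' s ν')
      * ((DeltaXir (R * N) 0 q : ℝ) : ℂ)⁻¹‖ ≤ x * y * (DeltaXir (R * N) 0 q)⁻¹ := by
    rw [← Complex.ofReal_inv, norm_mul, norm_mul, Complex.norm_real, Real.norm_eq_abs,
      abs_of_pos hapos]
    exact mul_le_mul_of_nonneg_right (mul_le_mul hA hB (norm_nonneg _) hx0) hapos.le
  have c := U_core_le hf.1 hg.1 hx0 hy0 hxM hyM hN0 hNq hfx hgy hθ0 hθ2 hapos.le ha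
  calc (Wc (R * N) k'' s ^ θ) ^ 2 * ‖dSym (R * N) k'' s ν * conj (dSym (R * N) k'' s ν')
        * ((DeltaXir (R * N) 0 q : ℝ) : ℂ)⁻¹‖
      ≤ (f * g) ^ (2 * θ) * (x * y * (DeltaXir (R * N) 0 q)⁻¹) :=
        mul_le_mul hWfg hw (norm_nonneg _) hfg0
    _ = (f * g) ^ (2 * θ) * x * y * (DeltaXir (R * N) 0 q)⁻¹ := by ring
    _ ≤ Real.pi ^ 2 * (Real.pi ^ 2 / 4) * (N : ℝ) ^ (-(4 * θ)) := c
    _ = Real.pi ^ 2 * (Real.pi ^ 2 / 4) / (N : ℝ) ^ (4 * θ) := by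
        rw [Real.rpow_neg hN0.le]; ring

end Unpaired

/-! ## §5 The diagonal piece and the assembled residual, `ν ≠ ν′` [folklore] -/

section Main

/-- the constant of the mixed diagonal piece: `CdgX + π²(π²/4) + Ccen`. [folklore] -/
def CdgX1 (d : ℕ) (a : ℝ) : ℝ := CdgX + Real.pi ^ 2 * (Real.pi ^ 2 / 4) + Ccen d a

/-- `0 ≤ CdgX1` (`a > 0`). [folklore] -/
theorem CdgX1_nonneg (d : ℕ) {a : ℝ} (ha : 0 < a) : 0 ≤ CdgX1 d a := by
  have h1 := CdgX_nonneg
  have h2 := (Ccen_nonneg d ha).2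
  unfold CdgX1; positivity

/-- the constant of the mixed residual for `θ ≤ 1/2`: `CdgX1 + CfrW`. [folklore] -/
def CX1op (d : ℕ) (a : ℝ) : ℝ := CdgX1 d a + CfrW d a

/-- the constant for all `θ ∈ [0, 1]`: `CX1op + CW1op` (`CW1op` = the all-directions constant of
`B5G183RateW1RankOne` / `B5G183RateWThetaHolds`). [folklore] -/
def CXop (d : ℕ) (a : ℝ) : ℝ := CX1op d a + CW1op d a

/-- `0 ≤ CX1op ≤ CXop`, `CW1op ≤ CXop` (`a > 0`). [folklore] -/
theorem CXop_bounds (d : ℕ) {a : ℝ} (ha : 0 < a) :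
    0 ≤ CX1op d a ∧ CX1op d a ≤ CXop d a ∧ CW1op d a ≤ CXop d a ∧ 0 ≤ CXop d a := by
  have h1 : 0 ≤ CX1op d a := add_nonneg (CdgX1_nonneg d ha) (CfrW_nonneg d ha)
  have h2 := CW1op_nonneg d ha
  unfold CXop
  exact ⟨h1, by linarith, by linarith, by linarith⟩

variable {N R : ℕ} [NeZero N] [NeZero R]

/-- **entrywise bound of the diagonal piece difference, weights `W^θ`, `ν ≠ ν′`, `θ ≤ 1/2`:** for every
class `K` of level `RN` and every component `μ`, `‖dg^{(RN)}(K, μ) − (extP dg^{(N)})(K, μ)‖ ≤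
CdgX1/N^{min(4θ,1)}` — King's `m = 0` classes off the centre (`diag_wθ_mixed_rate_le`), the centre
(`B5G183RateW1Diag.centre_diff_le`: rate `1/N`, no weight there), the `|m| ≥ 1` classes
(`diag_wθ_mixed_unpaired_le`, `N^{−4θ} ≤ N^{−min(4θ,1)}`). [cite: King1986, (4.19)–(4.20), (4.23) p.672;
Balaban1984PropagatorsI, (1.87) p.32, Prop. 1.1 (1.89) p.33] [folklore] -/
theorem dg_entry_mixed_diff_le (hN : 1 ≤ N) (hR : 1 ≤ R) (hRN : 1 ≤ R * N) (a : ℝ) (ha : 0 < a)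
    {s : Fin d → ℝ} (hs : ∀ ν, |s ν| ≤ Real.pi) (hs0 : s ≠ 0) {θ : ℝ} (hθ0 : 0 ≤ θ)
    (hθ2 : 2 * θ ≤ 1) {ν ν' : Fin d} (hne : ν ≠ ν') (I : (Fin d → Fin (R * N)) × Fin d) :
    ‖(balabanFiber (R * N) hRN a ha s hs hs0).dg (fun K => wθdSym (R * N) θ K s ν)
          (fun K => wθdSym (R * N) θ K s ν') I
        - extP R s ((balabanFiber N hN a ha s hs hs0).dg (fun k => wθdSym N θ k s ν)
          (fun k => wθdSym N θ k s ν')) I‖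
      ≤ CdgX1 d a / (N : ℝ) ^ min (4 * θ) 1 := by
  obtain ⟨ν₀, hν₀⟩ : ∃ ν, s ν ≠ 0 := Function.ne_iff.mp hs0
  obtain ⟨K, μ⟩ := I
  have hπ := Real.pi_pos
  have hN0 : (0 : ℝ) < N := by exact_mod_cast hN
  have hN1 : (1 : ℝ) ≤ N := by exact_mod_cast hN
  have hCX := CdgX_nonneg
  have hCc := (Ccen_nonneg d ha).2
  set t : ℝ := min (4 * θ) 1 with ht
  have ht1 : t ≤ 1 := min_le_right _ _
  have ht4 : t ≤ 4 * θ := min_le_left _ _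
  have hNt : 0 < (N : ℝ) ^ t := Real.rpow_pos_of_pos hN0 _
  have hNt1 : (N : ℝ) ^ t ≤ N := by
    calc (N : ℝ) ^ t ≤ (N : ℝ) ^ (1 : ℝ) := Real.rpow_le_rpow_of_exponent_le hN1 ht1
      _ = N := Real.rpow_one _
  have hNt4 : (N : ℝ) ^ t ≤ (N : ℝ) ^ (4 * θ) := Real.rpow_le_rpow_of_exponent_le hN1 ht4
  have hCW : CdgX ≤ CdgX1 d a ∧ Ccen d a ≤ CdgX1 d a ∧ Real.pi ^ 2 * (Real.pi ^ 2 / 4) ≤ CdgX1 d a := by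
    unfold CdgX1; refine ⟨?_, ?_, ?_⟩ <;> nlinarith [sq_nonneg Real.pi, sq_nonneg (Real.pi ^ 2)]
  by_cases hp : ∃ k : Fin d → Fin N, iota R k s = K
  · obtain ⟨k, rfl⟩ := hp
    rw [extP_iota hN hs]
    by_cases hk : k = 0
    · -- the centre: no weight
      subst hk
      rw [iota_zero hN hs, dg_wθ_centre hRN a ha hs hs0 θ ν ν' μ, dg_wθ_centre hN a ha hs hs0 θ ν ν' μ,
        wθdSym_zero_eq_w1dSym hRN θ hs ν, wθdSym_zero_eq_w1dSym hRN θ hs ν',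
        wθdSym_zero_eq_w1dSym hN θ hs ν, wθdSym_zero_eq_w1dSym hN θ hs ν']
      calc _ ≤ Ccen d a / N := centre_diff_le hN hR a ha hs hs0 ν ν' μ
        _ ≤ Ccen d a / (N : ℝ) ^ t := div_le_div_of_nonneg_left hCc hNt hNt1
        _ ≤ CdgX1 d a / (N : ℝ) ^ t := div_le_div_of_nonneg_right hCW.2.1 hNt.le
    · -- paired, off the centre
      have hK : iota R k s ≠ 0 := fun h =>
        hk (iota_injective hN hs (h.trans (iota_zero hN hs).symm))
      rw [dg_wθ_offcentre hRN a ha hs hs0 θ hK ν ν' μ, dg_wθ_offcentre hN a ha hs hs0 θ hk ν ν' μ,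
        Wc_iota hN k hs, ← mul_sub, norm_mul, Complex.norm_real, Real.norm_eq_abs,
        abs_of_nonneg (sq_nonneg _)]
      calc _ ≤ CdgX / (N : ℝ) ^ t := diag_wθ_mixed_rate_le hN hR hs ν₀ hν₀ hk hne hθ0 hθ2
        _ ≤ CdgX1 d a / (N : ℝ) ^ t := div_le_div_of_nonneg_right hCW.1 hNt.le
  · -- unpaired: the planted piece vanishes
    push Not at hp
    have hK : K ≠ 0 := fun h => hp 0 ((iota_zero hN hs).trans h.symm)
    rw [extP_unpaired _ hp, sub_zero, dg_wθ_offcentre hRN a ha hs hs0 θ hK ν ν' μ, norm_mul,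
      Complex.norm_real, Real.norm_eq_abs, abs_of_nonneg (sq_nonneg _)]
    calc _ ≤ Real.pi ^ 2 * (Real.pi ^ 2 / 4) / (N : ℝ) ^ (4 * θ) :=
          diag_wθ_mixed_unpaired_le hN hR hs hp hne hθ0 hθ2
      _ ≤ Real.pi ^ 2 * (Real.pi ^ 2 / 4) / (N : ℝ) ^ t :=
          div_le_div_of_nonneg_left (by positivity) hNt hNt4
      _ ≤ CdgX1 d a / (N : ℝ) ^ t := div_le_div_of_nonneg_right hCW.2.2 hNt.le

/-- **the diagonal piece of the `W^θ∂_ν ⊗ W^θ∂_{ν′}` residual, `ν ≠ ν′`, `θ ≤ 1/2`, is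
`O(N^{−min(4θ,1)})` in operator norm.** [cite: Balaban1984PropagatorsI, (1.83) p.31, (1.87) p.32,
Prop. 1.1 (1.89) p.33; King1986, (4.19)–(4.20), (4.23) p.672, (4.24) p.673] [folklore] -/
theorem opNorm_dg_piece_Wθ_mixed_le (hN : 1 ≤ N) (hR : 1 ≤ R) (hRN : 1 ≤ R * N) (a : ℝ) (ha : 0 < a)
    {s : Fin d → ℝ} (hs : ∀ ν, |s ν| ≤ Real.pi) (hs0 : s ≠ 0) {θ : ℝ} (hθ0 : 0 ≤ θ)
    (hθ2 : 2 * θ ≤ 1) {ν ν' : Fin d} (hne : ν ≠ ν') :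
    ‖Matrix.diagonal ((balabanFiber (R * N) hRN a ha s hs hs0).dg (fun K => wθdSym (R * N) θ K s ν)
          (fun K => wθdSym (R * N) θ K s ν'))
        - Matrix.diagonal (extP R s ((balabanFiber N hN a ha s hs hs0).dg
          (fun k => wθdSym N θ k s ν) (fun k => wθdSym N θ k s ν')))‖
      ≤ CdgX1 d a / (N : ℝ) ^ min (4 * θ) 1 := by
  have hN0 : (0 : ℝ) < N := by exact_mod_cast hN
  exact opNorm_diagonal_sub_le _ _ (div_nonneg (CdgX1_nonneg d ha) (Real.rpow_nonneg hN0.le _))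
    fun I => dg_entry_mixed_diff_le hN hR hRN a ha hs hs0 hθ0 hθ2 hne I

/-- **THE PLANTED ORDER-TWO `W^θ∂_ν ⊗ W^θ∂_{ν′}` DIFFERENCE, `ν ≠ ν′`, `θ ≤ 1/2`, IS `O(N^{−min(4θ,1)})`
IN OPERATOR NORM:** the four finite-rank pieces at `CfrW/N ≤ CfrW/N^{min(4θ,1)}`
(`B5G183RateWgtPieces.residualWθ_le_diag_add`) plus the free diagonal at `CdgX1/N^{min(4θ,1)}`
(`opNorm_dg_piece_Wθ_mixed_le`). [cite: Balaban1984PropagatorsI, (1.83) p.31, Prop. 1.1 (1.89) p.33;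
King1986, (4.19)–(4.20), (4.23) p.672, (4.24) p.673] [folklore] -/
theorem residualWθ_mixed_le (hN : 1 ≤ N) (hR : 1 ≤ R) (hRN : 1 ≤ R * N) (a : ℝ) (ha : 0 < a)
    {θ : ℝ} (hθ0 : 0 ≤ θ) (hθ2 : 2 * θ ≤ 1) {s : Fin d → ℝ} (hs : ∀ ν, |s ν| ≤ Real.pi)
    (hs0 : s ≠ 0) {ν ν' : Fin d} (hne : ν ≠ ν') :
    ‖sandwich (fun K => wθdSym (R * N) θ K s ν) (fun K => wθdSym (R * N) θ K s ν')
          (balabanFiber (R * N) hRN a ha s hs hs0).G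
        - plant R s (sandwich (fun k => wθdSym N θ k s ν) (fun k => wθdSym N θ k s ν')
          (balabanFiber N hN a ha s hs hs0).G)‖
      ≤ CX1op d a / (N : ℝ) ^ min (4 * θ) 1 := by
  have h1 := residualWθ_le_diag_add hN hR hRN a ha hθ0 hs hs0 ν ν'
  dsimp only at h1
  have h2 := opNorm_dg_piece_Wθ_mixed_le hN hR hRN a ha hs hs0 hθ0 hθ2 hne
  have hN0 : (0 : ℝ) < N := by exact_mod_cast hN
  have hN1 : (1 : ℝ) ≤ N := by exact_mod_cast hN
  have hNt : 0 < (N : ℝ) ^ min (4 * θ) 1 := Real.rpow_pos_of_pos hN0 _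
  have hNt1 : (N : ℝ) ^ min (4 * θ) 1 ≤ N :=
    calc (N : ℝ) ^ min (4 * θ) 1 ≤ (N : ℝ) ^ (1 : ℝ) :=
          Real.rpow_le_rpow_of_exponent_le hN1 (min_le_right _ _)
      _ = N := Real.rpow_one _
  have h3 : CfrW d a / N ≤ CfrW d a / (N : ℝ) ^ min (4 * θ) 1 :=
    div_le_div_of_nonneg_left (CfrW_nonneg d ha) hNt hNt1
  refine h1.trans ((add_le_add h2 h3).trans (le_of_eq ?_))
  rw [CX1op, add_div]

/-- **ORDER TWO, `U = 1`, WEIGHTS `W^θ∂_ν ⊗ W^θ∂_{ν′}` IN MIXED DIRECTIONS `ν ≠ ν′`, `0 ≤ θ ≤ 1/2`: THE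
eta-RATE HOLDS WITH EXPONENT `min(4θ, 1)`** (constant `CX1op d a`). [cite: Balaban1984PropagatorsI,
Prop. 1.1 (1.89) p.33; King1986, (4.20), (4.22)–(4.23) p.672, p.673] [folklore] -/
theorem orderTwoOpRateResidualWθoff_holds_of_le_half (d : ℕ) (a : ℝ) {θ : ℝ} (hθ0 : 0 ≤ θ)
    (hθ : θ ≤ 1 / 2) : OrderTwoOpRateResidualWθoff d a (CX1op d a) θ (min (4 * θ) 1) := by
  intro N R _ _ hN hRN ha s hs hs0 ν ν' hne hR
  exact residualWθ_mixed_le hN hR hRN a ha hθ0 (by linarith) hs hs0 hne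

/-- **ORDER TWO, `U = 1`, WEIGHTS `W^θ∂_ν ⊗ W^θ∂_{ν′}` IN MIXED DIRECTIONS `ν ≠ ν′`, `0 ≤ θ ≤ 1`: THE
eta-RATE HOLDS WITH EXPONENT `min(4θ, 1)`** — `OrderTwoOpRateResidualWθoff d a (CXop d a) θ (min (4θ) 1)`
for every `d` and every `a` (the currency quantifies `0 < a` internally): `θ ≤ 1/2` by
`orderTwoOpRateResidualWθoff_holds_of_le_half`, `θ ≥ 1/2` (`min(4θ,1) = 1`) by the all-directions exponent
`1` of `B5G183RateWThetaHolds.orderTwoOpRateResidualWθ_one_of_half_le`.  Compare the all-directions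
exponent `min(2θ,1)` (`B5G183RateWThetaHolds.orderTwoOpRateResidualWθ_holds`), sharp at `ν = ν′`
(`B5G183RateWThetaSharp`). [cite: Balaban1984PropagatorsI, Prop. 1.1 (1.89) p.33; King1986, (4.20),
(4.22)–(4.23) p.672, p.673] [folklore] -/
theorem orderTwoOpRateResidualWθoff_holds (d : ℕ) (a : ℝ) {θ : ℝ} (hθ0 : 0 ≤ θ) (hθ1 : θ ≤ 1) :
    OrderTwoOpRateResidualWθoff d a (CXop d a) θ (min (4 * θ) 1) := by
  intro N R _ _ hN hRN ha s hs hs0 ν ν' hne hR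
  have hb := CXop_bounds d ha
  rcases le_or_gt θ (1 / 2) with hθ | hθ
  · exact orderTwoOpRateResidualWθoff_of_le_const hb.2.1
      (orderTwoOpRateResidualWθoff_holds_of_le_half d a hθ0 hθ) N R hN hRN ha s hs hs0 ν ν' hne hR
  · have h := orderTwoOpRateResidualWθ_one_of_half_le d a hθ.le hθ1
    rw [min_eq_right (by linarith : (1 : ℝ) ≤ 4 * θ)]
    exact orderTwoOpRateResidualWθoff_of_le_const hb.2.2.1 (orderTwoOpRateResidualWθoff_of_Wθ h)
      N R hN hRN ha s hs hs0 ν ν' hne hR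

/-- `θ ≤ 1/4`: exponent `4θ`. [folklore] -/
theorem orderTwoOpRateResidualWθoff_four_mul (d : ℕ) (a : ℝ) {θ : ℝ} (hθ0 : 0 ≤ θ) (hθ : θ ≤ 1 / 4) :
    OrderTwoOpRateResidualWθoff d a (CXop d a) θ (4 * θ) := by
  have h := orderTwoOpRateResidualWθoff_holds d a hθ0 (by linarith)
  rwa [min_eq_left (by linarith)] at h

/-- `1/4 ≤ θ ≤ 1`: exponent `1` (the rate of the finite-rank pieces). [folklore] -/
theorem orderTwoOpRateResidualWθoff_one_of_quarter_le (d : ℕ) (a : ℝ) {θ : ℝ} (hθ : 1 / 4 ≤ θ)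
    (hθ1 : θ ≤ 1) : OrderTwoOpRateResidualWθoff d a (CXop d a) θ 1 := by
  have h := orderTwoOpRateResidualWθoff_holds d a (by linarith) hθ1
  rwa [min_eq_right (by linarith)] at h

/-- every smaller exponent `γ ≤ min(4θ,1)` (`a > 0`). [folklore] -/
theorem orderTwoOpRateResidualWθoff_of_le (d : ℕ) {a : ℝ} (ha : 0 < a) {θ γ : ℝ} (hθ0 : 0 ≤ θ)
    (hθ1 : θ ≤ 1) (hγ : γ ≤ min (4 * θ) 1) : OrderTwoOpRateResidualWθoff d a (CXop d a) θ γ :=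
  orderTwoOpRateResidualWθoff_mono (CXop_bounds d ha).2.2.2 hγ
    (orderTwoOpRateResidualWθoff_holds d a hθ0 hθ1)

/-- hence a constant exists for every `γ ≤ min(4θ,1)`: `∃ C, OrderTwoOpRateResidualWθoff d a C θ γ`.
[folklore] -/
theorem exists_orderTwoOpRateWθoff (d : ℕ) {a : ℝ} (ha : 0 < a) {θ γ : ℝ} (hθ0 : 0 ≤ θ)
    (hθ1 : θ ≤ 1) (hγ : γ ≤ min (4 * θ) 1) : ∃ C, OrderTwoOpRateResidualWθoff d a C θ γ :=
  ⟨CXop d a, orderTwoOpRateResidualWθoff_of_le d ha hθ0 hθ1 hγ⟩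

/-- **the gain over the all-directions exponent:** for `0 < θ < 1/2` the mixed exponent `min(4θ,1)`
exceeds `min(2θ,1) = 2θ`, the sharp all-directions exponent of `B5G183RateWThetaHolds.orderTwoOpRateWθ_iff`.
[folklore] -/
theorem mixed_exponent_gt {θ : ℝ} (hθ0 : 0 < θ) (hθ : θ < 1 / 2) : min (2 * θ) 1 < min (4 * θ) 1 := by
  rw [min_eq_left (by linarith : 2 * θ ≤ 1)]
  exact lt_min (by linarith) (by linarith)

end Main

end Literature.MathematicalPhysics.QuantumFieldTheory.Balaban1983to89.B5G183RateWThetaMixed
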